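import Summits.HodgeConjecture.HodgeConjecture.Theorems.VHCAbelianSchemesRoadNowhereDisplaceableDefs
import HarnessLib

/-!
# Scratch (plan-lens-HodgeAV-26512-negation g3, 2026-08-28) — crux stmt-HodgeConjecture-26512, LINE N′ «nowhere-displaceable», node (N-U)
# THE TWO-TORSION RE-CUT OF (N-U): (N-C) «jump loci are Zariski-closed» ∧ (N-U♭) «ONE non-jumping point upstairs» ⟹ (N-U) VERBATIM
research route conditional on HC_CM; not a corollary; nothing here proves (N-C), (N-U♭), (N-U), (S4), the crux, №4, HC_AV, HC_CM or HC; typed ≠ proved.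
`sorry` ONLY inside the two displayed inputs `stub_extJumpLocus_closed` (N-C) and `stub_oneNonJumpingPoint_End` (N-U♭); the composition is kernel-checked.
On paper (memo `PENCIL-26512-TWOTORSION.md`): for print's carrier `Ē_{a′}`, `a′` EVEN admissible (e.g. `(d, a′) = (6, 8)`), the 4032 two-torsion points
`(b₁, φ_Θ c)`, `c ≠ 0`, of `J × Ĵ` are non-jumping for `q^*Ē_{a′}` at EVERY non-hyperelliptic H-good datum — so (N-U♭) holds for print's object modulo (O₁).
-/

noncomputable section

open CategoryTheory CategoryTheory.Limits AlgebraicGeometry Topology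

namespace Summit.HodgeConjecture.HodgeConjecture.Cruxes.DiagLocalOfMarkmanPinnedForall.NowhereDisplaceable.TwoTorsion

set_option linter.dupNamespace false

open Literature.AlgebraicGeometry Literature.AlgebraicGeometry.Motives Literature.AlgebraicGeometry.Motives.AbelianVariety
open Literature.AlgebraicGeometry.HodgeTheory Literature.AlgebraicGeometry.Markman2025
open Literature.AlgebraicGeometry.KTheory (IsBoundedVBComplex)
open Literature.AlgebraicTopology.SingularHomology
open Summit.HodgeConjecture.HodgeConjecture.Ring2.SemiregularRepresentatives
open Summit.HodgeConjecture.HodgeConjecture.Ring2.SemiregularRepresentatives.MoverTrap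
open Summit.HodgeConjecture.HodgeConjecture.Ring2.SemiregularRepresentatives.NowhereDisplaceable (ProperJump DenseJump quotientPullbackComplex)

/-- (N-C) — **THE EXT-JUMP LOCUS OF A PULLED-BACK BOUNDED VECTOR-BUNDLE COMPLEX IS ZARISKI-CLOSED** (its `ℂ`-points are exactly those of a closed
subscheme of `J × Ĵ`): upper semicontinuity of `y ↦ dim Ext^i(τ_y^* F, F)` for the flat proper family of translates (finite locally free resolution +
`Rp_*𝓗om^•`), finitely many `i` for a bounded complex. TRUE infrastructure (derived semicontinuity), kernel XL; census-neutral like (N-F)/(N-I).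
[cite: GortzWedhorn2023, Thm. 23.139 (2) (p. 482)] [cite: HuybrechtsLehn2010, Prop. 2.1.10] -/
theorem stub_extJumpLocus_closed :
    ∀ (D : SecantQuotientDatum) (E : CochainComplex D.Y.X.left.Modules ℤ), IsBoundedVBComplex E →
      ∃ (V : SchemeOver ℂ) (ι : V ⟶ D.P.X), IsClosedImmersion ι.left ∧
        Set.range (AlgPoints.map (L := ℂ) ι) = extJumpLocus D.P (quotientPullbackComplex D E) := by
  sorry

/-- (N-U♭) — **ONE NON-JUMPING POINT UPSTAIRS**: at every End-trivial non-hyperelliptic H-good datum some served `AdmTw′`-pinned carrier `𝓓` on `Y` and some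
`p ∈ (J × Ĵ)(ℂ)` with `Ext^•(τ_p^* q^*𝓓.E, q^*𝓓.E) = 0`. For print's `Ē_{a′}`, `a′` even: `p = (b₁, φ_Θ c)` two-torsion with `c ≠ 0` (the descent twist
`D^{−a′}` dies on `P[2]`, the pure `Ĵ`-translation is a pure 2-torsion twist on the factor `I_{𝒵_C}`, and a non-trivial 2-torsion class of a
NON-HYPERELLIPTIC curve is never `𝒪(q − p)`); research residue = (O₁) only. [cite: Markman2025SecantWeil, §9.3 Lemma 9.3.3, 9.3.5, Remark 9.3.7]
[cite: Orlov2002DerivedAbelian, Thm. 2.10, Cor. 2.13] [cite: Lange2023AbelianVarietiesComplex, Prop. 4.1.6, 5.2.6] -/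
theorem stub_oneNonJumpingPoint_End :
    ∀ (C : ChernCharacterBetti) (D : SecantQuotientDatum) (θ₀ : complexBetti D.𝒥.J.X 2),
      ¬ D.𝒥.IsHyperelliptic → OrbitTranslatesDisjoint D.𝒥 D.G₁ D.G₂ → D.𝒥.J.IsPolarizationClassOf D.Θ θ₀ → EndTrivial D →
      ∃ γ ∈ secantQuotientServedClassesPinned D.Y.X (D.hY θ₀), ∃ 𝓓 : PinnedTwistedDatum C AdmTw' D.Y.X (D.hY θ₀) γ,
        ∃ p : D.P.Points ℂ, p ∉ extJumpLocus D.P (quotientPullbackComplex D 𝓓.E) := by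
  sorry

/-- **(N-U) VERBATIM from (N-C) ∧ (N-U♭)** (`Lines/NowhereDisplaceable.lean` v2 90448395a0403d43 l.270 `stub_upstairsProperJumpCarrierExists_End`): the closed
jump locus itself is the proper closed subscheme. [cite: Mukai1978, §3] -/
theorem upstairsProperJumpCarrierExists_End_of_closed_of_point
    (hC : ∀ (D : SecantQuotientDatum) (E : CochainComplex D.Y.X.left.Modules ℤ), IsBoundedVBComplex E →
      ∃ (V : SchemeOver ℂ) (ι : V ⟶ D.P.X), IsClosedImmersion ι.left ∧
        Set.range (AlgPoints.map (L := ℂ) ι) = extJumpLocus D.P (quotientPullbackComplex D E))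
    (hP : ∀ (C : ChernCharacterBetti) (D : SecantQuotientDatum) (θ₀ : complexBetti D.𝒥.J.X 2),
      ¬ D.𝒥.IsHyperelliptic → OrbitTranslatesDisjoint D.𝒥 D.G₁ D.G₂ → D.𝒥.J.IsPolarizationClassOf D.Θ θ₀ → EndTrivial D →
      ∃ γ ∈ secantQuotientServedClassesPinned D.Y.X (D.hY θ₀), ∃ 𝓓 : PinnedTwistedDatum C AdmTw' D.Y.X (D.hY θ₀) γ,
        ∃ p : D.P.Points ℂ, p ∉ extJumpLocus D.P (quotientPullbackComplex D 𝓓.E)) :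
    ∀ (C : ChernCharacterBetti) (D : SecantQuotientDatum) (θ₀ : complexBetti D.𝒥.J.X 2),
      ¬ D.𝒥.IsHyperelliptic → OrbitTranslatesDisjoint D.𝒥 D.G₁ D.G₂ → D.𝒥.J.IsPolarizationClassOf D.Θ θ₀ → EndTrivial D →
      ∃ γ ∈ secantQuotientServedClassesPinned D.Y.X (D.hY θ₀), ∃ 𝓓 : PinnedTwistedDatum C AdmTw' D.Y.X (D.hY θ₀) γ,
        ProperJump D.P (quotientPullbackComplex D 𝓓.E) := by
  intro C D θ₀ hnh hH hθ₀ hEnd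
  obtain ⟨γ, hγ, 𝓓, p, hp⟩ := hP C D θ₀ hnh hH hθ₀ hEnd
  obtain ⟨V, ι, hι, hV⟩ := hC D 𝓓.E 𝓓.bounded
  refine ⟨γ, hγ, 𝓓, V, ι, hι, ?_, ?_⟩
  · intro huniv
    exact hp (hV ▸ huniv ▸ Set.mem_univ p)
  · rw [hV]
    exact Set.subset_union_right

/-- The same, fed by the two stubs (so that `sorryAx` provenance is visible in the audit). -/
theorem upstairsProperJumpCarrierExists_End_of_twoTorsion :
    ∀ (C : ChernCharacterBetti) (D : SecantQuotientDatum) (θ₀ : complexBetti D.𝒥.J.X 2),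
      ¬ D.𝒥.IsHyperelliptic → OrbitTranslatesDisjoint D.𝒥 D.G₁ D.G₂ → D.𝒥.J.IsPolarizationClassOf D.Θ θ₀ → EndTrivial D →
      ∃ γ ∈ secantQuotientServedClassesPinned D.Y.X (D.hY θ₀), ∃ 𝓓 : PinnedTwistedDatum C AdmTw' D.Y.X (D.hY θ₀) γ,
        ProperJump D.P (quotientPullbackComplex D 𝓓.E) :=
  upstairsProperJumpCarrierExists_End_of_closed_of_point stub_extJumpLocus_closed stub_oneNonJumpingPoint_End

/-- **THE NEGATION SHAPE, one level below `DenseJump`**: if the jump locus of `q^*E` is closed (N-C) and dense off the identity (`DenseJump`), then EVERY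
point of `J × Ĵ` jumps — so a single non-jumping point refutes density. (For print's object the forced obstruction at a two-torsion point `(b₁, φ_Θ c)`,
`c ≠ 0`, reads «a non-trivial 2-torsion class of `C` lies in `C − C`», i.e. «`C` is hyperelliptic» — excluded by the datum.) [cite: Mukai1978, §3] -/
theorem extJumpLocus_eq_univ_of_denseJump_of_closed {D : SecantQuotientDatum} {E : CochainComplex D.Y.X.left.Modules ℤ}
    {V : SchemeOver ℂ} {ι : V ⟶ D.P.X} (hι : IsClosedImmersion ι.left)
    (hV : Set.range (AlgPoints.map (L := ℂ) ι) = extJumpLocus D.P (quotientPullbackComplex D E))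
    (hd : DenseJump D.P (quotientPullbackComplex D E)) :
    extJumpLocus D.P (quotientPullbackComplex D E) = Set.univ := by
  rw [← hV]
  exact hd V ι hι (hV ▸ Set.subset_union_right)

theorem not_denseJump_of_closed_of_point {D : SecantQuotientDatum} {E : CochainComplex D.Y.X.left.Modules ℤ}
    {V : SchemeOver ℂ} {ι : V ⟶ D.P.X} (hι : IsClosedImmersion ι.left)
    (hV : Set.range (AlgPoints.map (L := ℂ) ι) = extJumpLocus D.P (quotientPullbackComplex D E))
    {p : D.P.Points ℂ} (hp : p ∉ extJumpLocus D.P (quotientPullbackComplex D E)) :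
    ¬ DenseJump D.P (quotientPullbackComplex D E) :=
  fun hd => hp ((extJumpLocus_eq_univ_of_denseJump_of_closed hι hV hd).symm ▸ Set.mem_univ p)

end Summit.HodgeConjecture.HodgeConjecture.Cruxes.DiagLocalOfMarkmanPinnedForall.NowhereDisplaceable.TwoTorsion

end
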